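import Literature.MathematicalPhysics.QuantumLattice.HubbardPairDensityCouplingFloorOptimal
import Literature.MathematicalPhysics.QuantumLattice.FreeFermiGasPairingCostLog
import HarnessLib

/-!
# Ground-state `d`-wave pair density of the repulsive Hubbard torus away from half filling is `O(U log(1/U))`

Family `hubbard` / topic `MathematicalPhysics/QuantumLattice`; fourth stage of the coupling-floor
files (`U^{1/6}`, `√U`, `U^{2/3}`). With the logarithmic (Bardeen–Cooper–Schrieffer) pairing-cost
rate of `FreeFermiGasPairingCostLog.lean`, valid when the free Fermi level of the sector lies in
`[-4 + d₀, -d₀]` (away from the van Hove level and from the band bottom), the two-line energy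
balance gives:

* `hubbardTorus_groundState_pairLRO_coupling_floor_log`: a normalised ground state `ψ` of
  `hubbardTorus 2 L 1 U` (`U ≥ 0`) in a sector `(2n, S^z = 0)` with `n ≤ #{ε_L ≤ -d₀}`,
  `#{ε_L < -4 + d₀} < n`, `n ≤ L²`, `c·L² ≥ 12800`, `√d₀·L ≥ 40`, and `Re ⟨ψ, Δ_d†Δ_d ψ⟩ ≥ c·L⁴`
  (`c > 0`) forces `√d₀ · c / (4096 · log(4 + 32/√c)) ≤ U`;
* `pairDensity_le_mul_coupling_mul_log`: equivalently `c ≤ (4096/√d₀) · U · log(4 + 32/√c)` — the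
  ground-state `d`-wave pair density of the weakly repulsive Hubbard torus at a regular filling is
  `O_δ(U log(1/U))` as `U → 0⁺`;
* `re_expect_pairField_dWave_lt_of_groundStateInSector_log`: the a-priori form.

This is the endpoint of the energy-balance method: the pairing cost is now charged at the BCS rate,
so the only remaining slack towards the expected `e^{-O(1/U)}` law is the first-order kinetic budget
`U·L²` of the interacting ground state (`re_expect_hubbardTorus_zero_le_of_groundStateInSector`).

Sources: Bardeen–Cooper–Schrieffer, Phys. Rev. 108 (1957) 1175, §II–III; C. N. Yang, Rev. Mod.
Phys. 34 (1962) 694, §3; H. Tasaki, Physics and Mathematics of Quantum Many-Body Systems (2020)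
§2.2. Folklore finite-dimensional statements; no named facts, no definitions.
Tree search: `hubbardTorus_groundState_pairLRO_coupling_floor_opt`,
`re_expect_hubbardTorus_zero_le_of_groundStateInSector`, `freeDWavePairing_costs_energy_log_explicit`.
-/

noncomputable section

namespace Literature.MathematicalPhysics.QuantumLattice

open Matrix Finset Literature.Probability.LatticeModels
open scoped ComplexOrder ComplexConjugate

variable {L : ℕ} [NeZero L]

/-- **Coupling floor at the logarithmic rate.** If a normalised ground state `ψ` of
`hubbardTorus 2 L 1 U` (`U ≥ 0`) in a sector `(2n, S^z = 0)` (`n ≤ L²`, `n ≤ #{ε_L ≤ -d₀}`,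
`#{ε_L < -4 + d₀} < n`, `L ≥ 3`, `c·L² ≥ 12800`, `√d₀·L ≥ 40`) has `Re ⟨ψ, Δ_d†Δ_d ψ⟩ ≥ c·L⁴`
(`c, d₀ > 0`), then `√d₀·c/(4096·log(4 + 32/√c)) ≤ U`. Bardeen–Cooper–Schrieffer (1957) §II;
Tasaki (2020) §2.2. [folklore] -/
theorem hubbardTorus_groundState_pairLRO_coupling_floor_log {c U d₀ : ℝ} (hc : 0 < c) (hU : 0 ≤ U)
    (hd : 0 < d₀) (hL : 3 ≤ L) (hLc : 12800 ≤ c * (L : ℝ) ^ 2) (hLd : 40 ≤ Real.sqrt d₀ * L)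
    {n : ℕ} (hn : n ≤ L ^ 2)
    (hC1 : n ≤ (Finset.univ.filter fun k : TorusSite 2 L => torusBand L k ≤ -d₀).card)
    (hC2 : (Finset.univ.filter fun k : TorusSite 2 L => torusBand L k < (-4 : ℝ) + d₀).card < n)
    {ψ : Fock (Orb (FermionTorus 2 L))}
    (hψ : IsGroundStateInSector (hubbardTorus 2 L 1 U) (2 * n) 0 ψ) (h1 : star ψ ⬝ᵥ ψ = 1)
    (hY : c * (L : ℝ) ^ 4 ≤
      (star ψ ⬝ᵥ (((pairField dWaveFormFactor L)ᴴ * pairField dWaveFormFactor L) *ᵥ ψ)).re) :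
    Real.sqrt d₀ * c / (4096 * Real.log (4 + 32 / Real.sqrt c)) ≤ U := by
  have hcost := freeDWavePairing_costs_energy_log_explicit hc hd hL hLc hLd hψ.1 h1 hC1 hC2 hY
  have hfree := re_expect_hubbardTorus_zero_le_of_groundStateInSector hU hn hψ h1
  have hL2 : (0 : ℝ) < (L : ℝ) ^ 2 := by
    have : (0 : ℝ) < (L : ℝ) := by exact_mod_cast Nat.pos_of_ne_zero (NeZero.ne L)
    positivity
  have hmul : Real.sqrt d₀ * c / (4096 * Real.log (4 + 32 / Real.sqrt c)) * (L : ℝ) ^ 2 ≤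
      U * (L : ℝ) ^ 2 := by linarith
  exact le_of_mul_le_mul_right hmul hL2

/-- **The ground-state `d`-wave pair density at a regular filling is `O(U log(1/U))`.** Under the
hypotheses of `hubbardTorus_groundState_pairLRO_coupling_floor_log`:
`c ≤ (4096/√d₀) · U · log(4 + 32/√c)`. Bardeen–Cooper–Schrieffer (1957) §II–III. [folklore] -/
theorem pairDensity_le_mul_coupling_mul_log {c U d₀ : ℝ} (hc : 0 < c) (hU : 0 ≤ U)
    (hd : 0 < d₀) (hL : 3 ≤ L) (hLc : 12800 ≤ c * (L : ℝ) ^ 2) (hLd : 40 ≤ Real.sqrt d₀ * L)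
    {n : ℕ} (hn : n ≤ L ^ 2)
    (hC1 : n ≤ (Finset.univ.filter fun k : TorusSite 2 L => torusBand L k ≤ -d₀).card)
    (hC2 : (Finset.univ.filter fun k : TorusSite 2 L => torusBand L k < (-4 : ℝ) + d₀).card < n)
    {ψ : Fock (Orb (FermionTorus 2 L))}
    (hψ : IsGroundStateInSector (hubbardTorus 2 L 1 U) (2 * n) 0 ψ) (h1 : star ψ ⬝ᵥ ψ = 1)
    (hY : c * (L : ℝ) ^ 4 ≤
      (star ψ ⬝ᵥ (((pairField dWaveFormFactor L)ᴴ * pairField dWaveFormFactor L) *ᵥ ψ)).re) :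
    c ≤ 4096 / Real.sqrt d₀ * U * Real.log (4 + 32 / Real.sqrt c) := by
  have h := hubbardTorus_groundState_pairLRO_coupling_floor_log hc hU hd hL hLc hLd hn hC1 hC2 hψ h1 hY
  have hsd : 0 < Real.sqrt d₀ := Real.sqrt_pos.2 hd
  have hlog : 0 < Real.log (4 + 32 / Real.sqrt c) := by
    have : 0 < 32 / Real.sqrt c := by
      have := Real.sqrt_pos.2 hc
      positivity
    exact Real.log_pos (by linarith)
  rw [div_le_iff₀ (by positivity)] at h
  have key : 4096 / Real.sqrt d₀ * U * Real.log (4 + 32 / Real.sqrt c) =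
      U * (4096 * Real.log (4 + 32 / Real.sqrt c)) / Real.sqrt d₀ := by ring
  rw [key, le_div_iff₀ hsd]
  linarith

/-- **A-priori form at the logarithmic rate.** For `c, d₀ > 0`,
`0 ≤ U < √d₀·c/(4096·log(4 + 32/√c))` and the hypotheses above on `(L, n)`, EVERY normalised
ground state `ψ` of `hubbardTorus 2 L 1 U` in the sector `(2n, S^z = 0)` has
`Re ⟨ψ, Δ_d†Δ_d ψ⟩ < c·L⁴`. Bardeen–Cooper–Schrieffer (1957) §II. [folklore] -/
theorem re_expect_pairField_dWave_lt_of_groundStateInSector_log {c U d₀ : ℝ} (hc : 0 < c)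
    (hU0 : 0 ≤ U) (hU : U < Real.sqrt d₀ * c / (4096 * Real.log (4 + 32 / Real.sqrt c)))
    (hd : 0 < d₀) (hL : 3 ≤ L) (hLc : 12800 ≤ c * (L : ℝ) ^ 2) (hLd : 40 ≤ Real.sqrt d₀ * L)
    {n : ℕ} (hn : n ≤ L ^ 2)
    (hC1 : n ≤ (Finset.univ.filter fun k : TorusSite 2 L => torusBand L k ≤ -d₀).card)
    (hC2 : (Finset.univ.filter fun k : TorusSite 2 L => torusBand L k < (-4 : ℝ) + d₀).card < n)
    {ψ : Fock (Orb (FermionTorus 2 L))}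
    (hψ : IsGroundStateInSector (hubbardTorus 2 L 1 U) (2 * n) 0 ψ) (h1 : star ψ ⬝ᵥ ψ = 1) :
    (star ψ ⬝ᵥ (((pairField dWaveFormFactor L)ᴴ * pairField dWaveFormFactor L) *ᵥ ψ)).re <
      c * (L : ℝ) ^ 4 := by
  by_contra h
  push Not at h
  have := hubbardTorus_groundState_pairLRO_coupling_floor_log hc hU0 hd hL hLc hLd hn hC1 hC2 hψ h1 h
  linarith

end Literature.MathematicalPhysics.QuantumLattice
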